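import Summits.HodgeConjecture.HodgeConjecture.Theses.SecondaryPeriods
import Literature.AlgebraicGeometry.HodgeTheory.WeightOneHodgeStructuresRankTwo

/-!
# `RiemannWeightOne` (stmt-HodgeConjecture-16406) · Negative · the hypothesis `IsEffective` is load-bearing

Negative-side knowledge for the crux `SecondaryPeriods.RiemannWeightOne` (Riemann's theorem on
weight-one Hodge structures, geometric form: every finite-dimensional polarisable EFFECTIVE
weight-one `ℚ`-Hodge structure is a Hodge quotient of `H¹(X(ℂ); ℚ)` of a smooth projective `X/ℂ`),
from the crux-attack of refuter `rattack-stmt-HodgeConjecture-16406` (2026-08-17). All theorems are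
unconditional and sorry-free; the file introduces no definition.

* `exists_curve_with_model`, `riemannWeightOne_of_subsingleton`, `hyps_satisfiable_rank_two` —
  ANTI-VACUITY: the tree contains a smooth projective curve (`ℂ/ℤ[i]`, algebraised by
  `exists_isAnalytification_complexTorus_dimOne`) with a Hodge-symmetric Hodge model and
  `dim_ℚ H¹ = 2`; hence the `V = 0` instance of the crux holds, and a rank-2 polarisable effective
  weight-one Hodge structure exists (`H¹(E(ℂ); ℚ)`, polarised by Hodge–Riemann,
  `smoothProjective_hodgeStructure_isPolarizable_holds`), so the hypotheses of the crux are satisfiable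
  by a non-zero structure.
* `isPolarizable_splitting` — for an effective polarisable weight-one `H`, the two-type WEIGHT-3
  structure `S_H = ofSplitting (conj F¹H)` of the splitting `V_ℂ = conj F¹ ⊕ F¹` (types `(3,0)`,
  `(0,3)`) is polarised by the SAME form (`i³/i⁰ = i⁰/i¹ = -i`, `i⁰/i³ = i¹/i⁰ = i`); hence its Tate
  twist `S_H(1)` — weight one, types `(2,-1)` and `(-1,2)`, the NON-EFFECTIVE TWIN of `H` — is a
  polarisable weight-one structure on the same `V` (`not_isEffective_twin`).
* `riemannWeightOne_false_without_isEffective` — **the crux with `H.IsEffective` deleted is FALSE**: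
  a morphism of Hodge structures `f : H¹(X(ℂ); ℚ) → S_H(1)` maps `F⁰ H¹ = everything` into
  `F⁰ S_H(1) = F¹ S_H = conj F¹H`, so `f` surjective forces `conj F¹ H = V_ℂ = F¹ H`, and
  `F¹ ∩ conj F¹ = 0` makes `V_ℂ = 0`, contradicting `dim V = 2`. Any proof of the crux must use
  effectivity (in the printed proof it enters through the complex structure `J` read off
  `V_ℂ = V^{1,0} ⊕ V^{0,1}`, `exists_cx_riemannForm_hom_of_isPolarizable`).

The crux itself (which keeps `IsEffective`) is untouched: its rank-2 case is the tree theorem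
`weightOne_polarizable_eq_range_of_smoothProjective_of_finrank_eq_two`, and it follows from
Lefschetz's theorem alone (`weightOne_polarizable_eq_range_of_smoothProjective_of_lefschetz`).

References: C. Voisin, *Hodge Theory and Complex Algebraic Geometry I* (2002), §7.1.1–7.1.2, §7.2.2,
§7.3.1; P. Deligne, *Théorie de Hodge II* (1971), 2.1.13–2.1.15 (Tate twists and polarisations).
-/

noncomputable section

-- `Summit.HodgeConjecture.HodgeConjecture.Theorems…` is the mandated namespace (single-conjunct summit:
-- Sub = Summit), which `linter.dupNamespace` flags on every declaration; the lakefile turns the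
-- linter off tree-wide (weak option), restated here so stand-alone elaboration is warning-free too.
set_option linter.dupNamespace false

namespace Summit.HodgeConjecture.HodgeConjecture.Theorems.RiemannWeightOne.Negative

open scoped TensorProduct
open Literature.AlgebraicGeometry.Motives Literature.AlgebraicGeometry.Motives.HodgeStructure
open Literature.AlgebraicGeometry.HodgeTheory Literature.Geometry.Kaehler
  Literature.NumberTheory.Transcendental Literature.AlgebraicTopology.SingularHomology

universe u

/-! ### Anti-vacuity: a curve, the `V = 0` instance, a rank-2 polarisable effective structure -/

/-- The conclusion's existential is inhabited: the elliptic curve `ℂ/ℤ[i]` (period isomorphism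
`ℝ² ≃ ℂ¹` the identity) as a smooth projective `ℂ`-scheme of dimension `1` with a Hodge-symmetric
Hodge model and `dim_ℚ H¹ = 2`. [folklore] -/
theorem exists_curve_with_model :
    ∃ (X : SchemeOver ℂ) (_ : IsSmoothProjective 1 X) (B : HodgeModel 1 X) (_ : B.IsHodgeSymmetric),
      Module.finrank ℚ (singularCohomology ℚ ℚ (ComplexPoints X) 1) = 2 := by
  -- the square lattice `ℤ² ⊂ ℝ² ≅ ℂ = ℂ¹`
  obtain ⟨X, hX, φ, hφ⟩ := exists_isAnalytification_complexTorus_dimOne (ι := Fin 2)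
    ((ContinuousLinearEquiv.piFinTwo ℝ (fun _ => ℝ)).trans
      (Complex.equivRealProdCLM.symm.trans (ContinuousLinearEquiv.funUnique (Fin 1) ℝ ℂ).symm))
  obtain ⟨B, hB, u, -⟩ := exists_hodgeModel_weightOne_of_complexTorus _ hX φ hφ
  exact ⟨X, hX, B, hB, by rw [u.finrank_eq]; simp⟩

/-- Degenerate instance `V = 0` of the crux: TRUE (the zero morphism from `H¹` of the curve).
[folklore] -/
theorem riemannWeightOne_of_subsingleton ⦃V : Type⦄ [AddCommGroup V] [Module ℚ V]
    [Module.Finite ℚ V] [Subsingleton V] (H : HodgeStructure V 1) :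
    ∃ (g : ℕ) (X : SchemeOver ℂ) (hX : IsSmoothProjective g X) (B : HodgeModel g X)
      (hB : B.IsHodgeSymmetric)
      (f : HodgeStructure.Hom ((B.hodgeStructure hX hB 1).cast Nat.cast_one) H),
      Function.Surjective f.toLinearMap := by
  obtain ⟨X, hX, B, hB, -⟩ := exists_curve_with_model
  refine ⟨1, X, hX, B, hB, ⟨0, fun p => ?_⟩, fun v => ⟨0, Subsingleton.elim _ _⟩⟩
  rw [LinearMap.baseChange_zero, Submodule.map_zero]
  exact bot_le

/-- The weight-one structure of a Hodge model is effective (`F^p = 0` for `p ≥ 2`). [folklore] -/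
theorem isEffective_hodgeStructure_one {X : SchemeOver ℂ} {n : ℕ} (hX : IsSmoothProjective n X)
    (B : HodgeModel n X) (hB : B.IsHodgeSymmetric) :
    ((B.hodgeStructure hX hB 1).cast Nat.cast_one).IsEffective := by
  intro p q hne
  by_contra hcon
  apply hne
  by_cases hpq : p + q = 1
  · rw [piece_of_add_eq _ hpq]
    rcases not_and_or.1 hcon with hp | hq
    · have hq2 : 2 ≤ q := by omega
      rw [cast_F, cast_F, HodgeModel.hodgeStructure_one_F_eq_bot B hX hB hq2, complexConj_bot,
        inf_bot_eq]
    · have hp2 : 2 ≤ p := by omega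
      rw [cast_F, HodgeModel.hodgeStructure_one_F_eq_bot B hX hB hp2, bot_inf_eq]
  · exact piece_eq_bot_of_add_ne _ hpq

/-- NON-VACUITY of the hypotheses of the crux: a rank-2 polarisable effective weight-one `ℚ`-Hodge
structure exists in the tree (`H¹(E(ℂ); ℚ)` of the elliptic curve, polarised by Hodge–Riemann).
[folklore] -/
theorem hyps_satisfiable_rank_two :
    ∃ (V : Type) (_ : AddCommGroup V) (_ : Module ℚ V) (_ : Module.Finite ℚ V)
      (H : HodgeStructure V 1), H.IsPolarizable ∧ H.IsEffective ∧ Module.finrank ℚ V = 2 := by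
  obtain ⟨X, hX, B, hB, h2⟩ := exists_curve_with_model
  haveI : Module.Finite ℚ (singularCohomology ℚ ℚ (ComplexPoints X) 1) :=
    Module.finite_of_finrank_eq_succ h2
  exact ⟨singularCohomology ℚ ℚ (ComplexPoints X) 1, inferInstance, inferInstance, inferInstance,
    (B.hodgeStructure hX hB 1).cast Nat.cast_one,
    (smoothProjective_hodgeStructure_isPolarizable_holds hX B hB 1).cast _,
    isEffective_hodgeStructure_one hX B hB, h2⟩

/-! ### The non-effective twin `S_H(1)` of an effective weight-one structure `H` -/

section Twin

variable {V : Type u} [AddCommGroup V] [Module ℚ V]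

/-- `conj F¹ ⊕ F¹ = V_ℂ` for a weight-one structure (opposedness at `(1,1)`). [folklore] -/
theorem isCompl_conj_F_one (H : HodgeStructure V 1) :
    IsCompl (complexConj (H.F 1)) (complexConj (complexConj (H.F 1))) := by
  rw [complexConj_complexConj]
  exact (H.isCompl_F_complexConj 1 1 (by norm_num)).symm

/-- `0 < 3` in `ℤ` (the weight of the two-type structure `S_H`). [folklore] -/
theorem zero_lt_three : (0 : ℤ) < 3 := by norm_num

/-- `3 - 2·1 = 1` in `ℤ` (the weight of the Tate twist `S_H(1)`). [folklore] -/
theorem three_sub_two : (3 : ℤ) - 2 * 1 = 1 := by norm_num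

/-- `i³ · (i⁰)⁻¹ = i⁰ · (i¹)⁻¹` (both `-i`). [folklore] -/
theorem I_zpow_three_zero : Complex.I ^ (3 : ℤ) * (Complex.I ^ (0 : ℤ))⁻¹ =
    Complex.I ^ (0 : ℤ) * (Complex.I ^ (1 : ℤ))⁻¹ := by
  have h3 : Complex.I ^ (3 : ℤ) = -Complex.I := by
    rw [show (3 : ℤ) = ((3 : ℕ) : ℤ) from rfl, zpow_natCast, pow_succ, pow_two, Complex.I_mul_I]
    ring
  rw [h3, zpow_zero, zpow_one, inv_one, mul_one, one_mul, Complex.inv_I]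

/-- `i⁰ · (i³)⁻¹ = i¹ · (i⁰)⁻¹` (both `i`). [folklore] -/
theorem I_zpow_zero_three : Complex.I ^ (0 : ℤ) * (Complex.I ^ (3 : ℤ))⁻¹ =
    Complex.I ^ (1 : ℤ) * (Complex.I ^ (0 : ℤ))⁻¹ := by
  have h3 : Complex.I ^ (3 : ℤ) = -Complex.I := by
    rw [show (3 : ℤ) = ((3 : ℕ) : ℤ) from rfl, zpow_natCast, pow_succ, pow_two, Complex.I_mul_I]
    ring
  rw [h3, zpow_zero, zpow_one, inv_one, mul_one, one_mul, inv_neg, Complex.inv_I, neg_neg]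

/-- **A polarisation of an effective weight-one `H` polarises the weight-3 two-type structure
`S_H = ofSplitting (conj F¹H)` of the splitting `conj F¹ ⊕ F¹` (types `(3,0) = conj F¹`,
`(0,3) = F¹`), by the same form**: the first relation by conjugating `Q(F¹, F¹) = 0`
(`form_baseChange_conj`); the second because `(3,0) ↔ (0,1)` and `(0,3) ↔ (1,0)` carry the same
power `i^{p-q}`. [cite: VoisinHodgeI2002, §7.1.2] [cite: DeligneHodgeII1971, 2.1.15] -/
theorem isPolarizable_splitting (H : HodgeStructure V 1) (heff : H.IsEffective)
    (hpol : H.IsPolarizable) :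
    (ofSplitting (complexConj (H.F 1)) (isCompl_conj_F_one H) zero_lt_three).IsPolarizable := by
  obtain ⟨Q⟩ := hpol
  refine ⟨{ form := Q.form, flip_form := ?_, form_apply_eq_zero := ?_, pos := ?_ }⟩
  · rw [show (3 : ℤ).negOnePow = (1 : ℤ).negOnePow by
      rw [Int.negOnePow_one, show (3 : ℤ) = 2 * 1 + 1 by norm_num, Int.negOnePow_two_mul_add_one]]
    exact Q.flip_form
  · intro p x hx y hy
    rw [ofSplitting_F] at hx hy
    by_cases hp : p ≤ 0
    · rw [twoStepFiltration_of_lt _ (by omega) (by omega), Submodule.mem_bot] at hy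
      rw [hy, map_zero]
    by_cases hp4 : 3 < p
    · rw [twoStepFiltration_of_lt _ (by omega) hp4, Submodule.mem_bot] at hx
      rw [hx, map_zero, LinearMap.zero_apply]
    rw [twoStepFiltration_of_pos_of_le _ (by omega) (by omega), mem_complexConj] at hx hy
    have h := Q.form_apply_eq_zero 1 (conj x) hx (conj y)
      (by rw [show (1 : ℤ) + 1 - 1 = 1 by norm_num]; exact hy)
    rwa [form_baseChange_conj, map_eq_zero] at h
  · intro p q hpq x hx hx0
    by_cases h30 : p = 3 ∧ q = 0
    · obtain ⟨rfl, rfl⟩ := h30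
      rw [piece_ofSplitting_self_zero] at hx
      have hx' : x ∈ H.piece 0 1 := by
        rw [piece_of_add_eq _ (by norm_num), weightOne_F_eq_top_of_nonpos H heff le_rfl, top_inf_eq]
        exact hx
      obtain ⟨r, hr, h⟩ := Q.pos 0 1 (by norm_num) x hx' hx0
      exact ⟨r, hr, by rw [← h, I_zpow_three_zero]⟩
    by_cases h03 : p = 0 ∧ q = 3
    · obtain ⟨rfl, rfl⟩ := h03
      rw [piece_ofSplitting_zero_self, complexConj_complexConj, weightOne_F_one_eq_piece H heff] at hx
      obtain ⟨r, hr, h⟩ := Q.pos 1 0 (by norm_num) x hx hx0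
      exact ⟨r, hr, by rw [← h, I_zpow_zero_three]⟩
    · rw [piece_ofSplitting_eq_bot _ _ _ h30 h03, Submodule.mem_bot] at hx
      exact (hx0 hx).elim

/-- The twin `S_H(1)` (weight one, same `V`) has the NON-EFFECTIVE type `(2,-1)`:
`V^{2,-1}(S_H(1)) = conj F¹ H`; in particular it is not effective as soon as `V ≠ 0`.
[cite: DeligneHodgeII1971, 2.1.13–2.1.14] -/
theorem not_isEffective_twin (H : HodgeStructure V 1) (hV : (⊤ : Submodule ℂ (ℂ ⊗[ℚ] V)) ≠ ⊥) :
    ¬ (((ofSplitting (complexConj (H.F 1)) (isCompl_conj_F_one H) zero_lt_three).tateTwist 1).cast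
        three_sub_two).IsEffective := by
  intro heff
  have h := heff 2 (-1)
  rw [piece_of_add_eq _ (by norm_num), cast_F, cast_F, tateTwist_F, tateTwist_F, ofSplitting_F,
    ofSplitting_F, twoStepFiltration_of_pos_of_le _ (by norm_num) (by norm_num),
    twoStepFiltration_of_le_zero _ (by norm_num), complexConj_top, inf_top_eq] at h
  by_cases hb : complexConj (H.F 1) = ⊥
  · -- then `F¹ = ⊥` too and `⊥ ⊕ ⊥ = V_ℂ` forces `V_ℂ = 0`
    have h1 : H.F 1 = ⊥ := by rw [← complexConj_complexConj (H.F 1), hb, complexConj_bot]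
    have hc := (H.isCompl_F_complexConj 1 1 (by norm_num)).sup_eq_top
    rw [h1, complexConj_bot, bot_sup_eq] at hc
    exact hV hc.symm
  · exact absurd (h hb).2 (by norm_num)

end Twin

/-! ### The crux without `IsEffective` is false -/

/-- **`IsEffective` is load-bearing in `RiemannWeightOne`.** Deleting the hypothesis
`H.IsEffective` from the crux gives a FALSE statement: apply it to the polarisable non-effective twin
`S_H(1)` of the tree's rank-2 structure `H = H¹(E(ℂ); ℚ)`; a morphism of Hodge structures
`f : H¹(X(ℂ); ℚ) → S_H(1)` satisfies `f_ℂ(F⁰) ⊆ F⁰ S_H(1) = conj F¹H` with `F⁰ H¹(X) = everything`,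
so `f` surjective forces `conj F¹ H = V_ℂ`, whence `F¹ H = V_ℂ` and `F¹ ∩ conj F¹ = 0` gives
`V_ℂ = 0`, contradicting `dim V = 2`. (Morphisms preserve Hodge types and `H¹` of a smooth
projective variety only has types `(1,0)`, `(0,1)`.) [cite: VoisinHodgeI2002, §7.2.2 and §7.3.1] -/
theorem riemannWeightOne_false_without_isEffective :
    ¬ (∀ ⦃V : Type⦄ [AddCommGroup V] [Module ℚ V] [Module.Finite ℚ V] (H : HodgeStructure V 1),
        H.IsPolarizable →
        ∃ (g : ℕ) (X : SchemeOver ℂ) (hX : IsSmoothProjective g X) (B : HodgeModel g X)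
          (hB : B.IsHodgeSymmetric)
          (f : HodgeStructure.Hom ((B.hodgeStructure hX hB 1).cast Nat.cast_one) H),
          Function.Surjective f.toLinearMap) := by
  intro h
  obtain ⟨V, _, _, _, H, hpol, heff, hV⟩ := hyps_satisfiable_rank_two
  obtain ⟨g, X, hX, B, hB, f, hf⟩ :=
    h _ (((isPolarizable_splitting H heff hpol).tateTwist 1).cast three_sub_two)
  -- `f_ℂ(F⁰ H¹(X)) ⊆ F⁰ S_H(1) = conj F¹ H`, and `F⁰ H¹(X) = ⊤`, `range f_ℂ = ⊤`
  have h0 := f.map_F_le 0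
  rw [cast_F, cast_F, tateTwist_F, ofSplitting_F, twoStepFiltration_of_pos_of_le _ (by norm_num)
      (by norm_num), HodgeModel.hodgeStructure_F, HodgeModel.ratF_of_nonpos B hX 1 le_rfl,
    Submodule.map_top, range_baseChange, LinearMap.range_eq_top.2 hf, Submodule.baseChange_top,
    top_le_iff] at h0
  -- so `conj F¹ = ⊤ = F¹`, and opposedness `F¹ ⊓ conj F¹ = ⊥` makes `V_ℂ` trivial
  have h1 : H.F 1 = ⊤ := by rw [← complexConj_complexConj (H.F 1), h0, complexConj_top]
  have hc := (H.isCompl_F_complexConj 1 1 (by norm_num)).inf_eq_bot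
  rw [h1, complexConj_top, top_inf_eq] at hc
  have hsub : Subsingleton (ℂ ⊗[ℚ] V) := subsingleton_of_forall_eq 0 fun x => by
    have hx : x ∈ (⊤ : Submodule ℂ (ℂ ⊗[ℚ] V)) := Submodule.mem_top
    rwa [hc, Submodule.mem_bot] at hx
  have hfin : Module.finrank ℂ (ℂ ⊗[ℚ] V) = 2 := by rw [Module.finrank_baseChange, hV]
  rw [Module.finrank_zero_of_subsingleton] at hfin
  exact absurd hfin (by norm_num)

end Summit.HodgeConjecture.HodgeConjecture.Theorems.RiemannWeightOne.Negative

end
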